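import Literature.AnabelianGeometry.EtaleTheta.SettingModelChiLevelKernels
import Literature.AnabelianGeometry.EtaleTheta.SettingModelChiCoverings
import Literature.AnabelianGeometry.EtaleTheta.SettingModelThetaCentreZHat
import Literature.AnabelianGeometry.EtaleTheta.SettingModelChiSec2Hyps
import HarnessLib

/-!
# The χ-twisted root model of [EtTh] §1: the covering `X̲̲ → X` of type `(1, (ℤ/l)^Θ)` — the `E`-free clauses
# of `EtaleThetaData.DoubleUnderline` at the constituents of `modelχ` (R78 cluster, hand #2′)

Mochizuki, *The étale theta function …*, Publ. RIMS **45** (2009) [EtTh], §2, Def. 2.5 (i) p. 39, Prop. 2.2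
(ii)/(iii) p. 37, Def. 2.7 p. 41, Prop. 2.12 (i) p. 45 [cite: MochizukiEtTh2009, Def 2.5 (i) p.39]: "the quotient
`Π_X ↠ Q` factors through the natural quotient `Π^tp_X ↠ Ẑ` determined by `Π^tp_X ↠ Z`"; "`Y̲̲ → Y` of degree `l`";
"`Ker(Δ^Θ_* ↠ Δ^ell_*) = l·Δ_Θ`".  abc-iut cell, layer L2, prover abc-iut-L2-d1 (gen 5), R78 cluster hand #2′
(abc-iut-L2-lead RULINGS #13 R100; integrator abc-iut-L6-d6): the `E`-indexed non-vacuity witnesses at the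
χ-twisted model.  abc-iut-L2-t8's `EtaleThetaData.DoubleUnderline E l` (`DoubleUnderline.lean`) records THE
CHOICE `X̲̲` as data: `Π^tp_X̲̲ ≤ Π^tp_X` open, `Π^tp_Ÿ ∩ Π^tp_X̲̲ ↠ G_K`, `toZ(Π^tp_X̲̲) = l·Z`,
`[Π^tp_Y : Π^tp_Y ∩ Π^tp_X̲̲] = l`, `θ(Π^tp_X̲̲) ∩ Δ_Θ = l·Δ_Θ`, and the `E`-dependent clause `eta_res`.

THIS FILE (proof-only apart from the two subgroup definitions `dUU`, `Huuχ`; over abc-iut-w5-d249's F4 carrier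
`PiTpχ = Γ ⋊_χ G_{ℚ_p}` (`SettingModelChiSemidirect`), abc-iut-L2-t1's F5a coverings `YNχ`/`chiTwistData`
(`SettingModelChiCoverings`), abc-iut-L6-d6's `Ẑ`-coordinates `c^t` on the theta centre
(`SettingModelThetaCentreZHat`) and this seat's `CurveTheta` quotients / `mem_ellKerχ_iff` / `fieldKN_bot_qModel_two`)
constructs the EXPLICIT choice
  `Π^tp_X̲̲ := Huuχ p l := {(γ, σ) ∈ Γ ⋊_χ G_{ℚ_p} | ĥ_l(pr₁ γ) has x = 0 and z = 0}`
("degree `≡ 0 (mod l)` and `z`-coordinate `≡ 0 (mod l)`" — a subgroup because the Heisenberg cross term `x₁·y₂`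
dies mod `l` once `x₁ ≡ 0`, and `G_{ℚ_p}`-stable because the twist `θ_{χ σ}` scales `z` by `χ_l σ`), and PROVES the
five `E`-free clauses at the constituents of abc-iut-L2-t1's record `ThetaSetting.modelχ` (F5b):
* `isOpen_Huuχ`;
* `map_augχ_YNχ_two_inf_Huuχ` — `(Π^tp_{Y₂} ∩ Π^tp_X̲̲) ↠ G_{ℚ_p}` (`Π^tp_Ÿ = Π^tp_{Y₂}` under `K = K̈`);
* `map_toZ_Huuχ` — `toZ(Π^tp_X̲̲) = l·ℤ` (witness `(η(a^l), l)`);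
* **`relIndex_Huuχ_inf_ker_toZ`** — `[Π^tp_Y : Π^tp_Y ∩ Π^tp_X̲̲] = l`: `Π^tp_Y ∩ Π^tp_X̲̲` is the stabiliser of `0`
  for the TRANSITIVE affine action `(γ, σ) • t := z_l(γ) + χ_l(σ)·t` of `Π^tp_Y` on `ℤ/l` (orbit–stabiliser);
* **`pow_mem_map_toTheta_Huuχ`**, **`exists_pow_eq_of_mem_map_toTheta_Huuχ`** — `θ(Π^tp_X̲̲) ∩ Δ_Θ = l·Δ_Θ`: an
  element of the centre with `z_l = 0` has `Ẑ`-coordinate `t` with `t mod l = 0`, hence `t = s^l`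
  (`ZHatLevel.level_eq_one_iff_exists_pow`), hence is the `l`-th power of `c^s`.
The record-level assembly (`(modelχ p).GtpYdd = YNχ p 2` by `Sec2Hyps`, `GK = ⊤`, `lDeltaTheta`) is three lines
per clause once F5b lands; `eta_res` waits for abc-iut-L2-t6's F7 (`etaDd` at `modelχ`): for the `Ẑ`-coordinate
crossed homomorphism it holds by the same divisibility.  SEMI-SYNTHETIC MODEL, consistency evidence only; nothing
of [EtTh] asserted; no side taken on [IUTchIII] Cor. 3.12.
-/

noncomputable section

namespace Literature.AnabelianGeometry.EtaleTheta.SettingModel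

open Literature.AnabelianGeometry.SemiGraphs _root_.Function
open scoped commutatorElement

/-! ### Computations in `Γ` (degrees and levels of the standard elements) -/

/-- The `x`-coordinate of `ĥ_N(pr₁ γ)` is the degree `pr₂ γ` reduced mod `N` (`ê ∘ pr₁ = ι ∘ pr₂` on `Γ`).
[cite: MochizukiEtTh2009, §1 p.12] -/
theorem levelHom_x_eq_cast (N : ℕ+) (γ : Gfp) :
    (levelHom N γ).x = ((Multiplicative.toAdd (gfpSnd γ) : ℤ) : ZMod N) := by
  have h := hHat_x_eq_modN_eHat N (gfpFst γ)
  rw [gfpFst_apply, (mem_Gfp _).mp γ.2, modN_iotaZ] at h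
  exact Multiplicative.ofAdd.injective h

/-- `pr₂ (η g, expA g) = expA g`. [cite: MochizukiEtTh2009, §1 p.12] -/
theorem gfpSnd_gfpOf (g : F₂) : gfpSnd (gfpOf g) = expA g := rfl

/-- `expA (a^k) = k`. [cite: MochizukiEtTh2009, §1 p.12] -/
theorem expA_of_zero_zpow (k : ℤ) : expA (FreeGroup.of 0 ^ k) = Multiplicative.ofAdd k := by
  rw [expA_apply, map_zpow, heisHom_of_zero, Heis.zpow_eq_of_mul_eq_zero _ (by simp)]
  simp

/-- `ĥ_N(η(a^k)) = (k, 0, 0)`. [cite: MochizukiEtTh2009, §1 p.12] -/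
theorem levelHom_gfpOf_of_zero_zpow (N : ℕ+) (k : ℤ) :
    levelHom N (gfpOf (FreeGroup.of 0 ^ k)) = ⟨(k : ZMod N), 0, 0⟩ := by
  rw [levelHom_gfpOf, map_zpow, heisHom_of_zero, Heis.zpow_eq_of_mul_eq_zero _ (by simp)]
  ext <;> simp

/-- `ĥ_N(η(c^k)) = (0, 0, k)` for `c = ⁅a, b⁆`. [cite: MochizukiEtTh2009, §1 p.12] -/
theorem levelHom_gfpOf_commutator_zpow (N : ℕ+) (k : ℤ) :
    levelHom N (gfpOf (⁅FreeGroup.of (0 : Fin 2), FreeGroup.of 1⁆ ^ k)) = ⟨0, 0, (k : ZMod N)⟩ :=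
  hHat_eta_commutator_zpow N k

/-- `(η(c^k), 1) ∈ Ker pr₂` (the commutator has degree `0`). [cite: MochizukiEtTh2009, §1 p.12] -/
theorem gfpOf_commutator_zpow_mem_ker (k : ℤ) :
    gfpOf (⁅FreeGroup.of (0 : Fin 2), FreeGroup.of 1⁆ ^ k) ∈ gfpSnd.ker := by
  rw [MonoidHom.mem_ker, gfpSnd_gfpOf, map_zpow, expA_apply, heisHom_commutator]
  simp

variable (p : ℕ) [Fact p.Prime]

/-! ### The geometric part `{l ∣ deg, l ∣ z}` of `Π^tp_X̲̲` -/

/-- **The `Γ`-part of `Π^tp_X̲̲` in the χ-model**: `{γ ∈ Γ | ĥ_l(pr₁ γ) has x = 0 and z = 0}` — degree `≡ 0` and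
`z`-coordinate `≡ 0 (mod l)`; a subgroup since the cross term `x₁·y₂` of the Heisenberg law vanishes once `x₁ = 0`.
[cite: MochizukiEtTh2009, Def 2.5 (i) p.39] -/
def dUU (l : ℕ+) : Subgroup Gfp where
  carrier := {γ | (levelHom l γ).x = 0 ∧ (levelHom l γ).z = 0}
  one_mem' := ⟨by simp, by simp⟩
  mul_mem' := by
    rintro a b ⟨hax, haz⟩ ⟨hbx, hbz⟩
    refine ⟨?_, ?_⟩
    · simp only [map_mul, Heis.mul_x, hax, hbx, add_zero]
    · simp only [map_mul, Heis.mul_z, haz, hbz, hax, zero_mul, add_zero]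
  inv_mem' := by
    rintro a ⟨hax, haz⟩
    refine ⟨?_, ?_⟩
    · simp only [map_inv, Heis.inv_x, hax, neg_zero]
    · simp only [map_inv, Heis.inv_z, haz, hax, neg_zero, zero_mul, add_zero]

variable {p} in
/-- [cite: MochizukiEtTh2009, Def 2.5 (i) p.39] -/
theorem mem_dUU_iff (l : ℕ+) (γ : Gfp) : γ ∈ dUU l ↔ (levelHom l γ).x = 0 ∧ (levelHom l γ).z = 0 :=
  Iff.rfl

variable {p} in
/-- `γ ∈ dUU l` iff `l ∣ pr₂ γ` and `(ĥ_l pr₁ γ).z = 0`. [cite: MochizukiEtTh2009, Def 2.5 (i) p.39] -/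
theorem mem_dUU_iff_dvd (l : ℕ+) (γ : Gfp) :
    γ ∈ dUU l ↔ ((l : ℕ) : ℤ) ∣ Multiplicative.toAdd (gfpSnd γ) ∧ (levelHom l γ).z = 0 := by
  rw [mem_dUU_iff, levelHom_x_eq_cast, ZMod.intCast_zmod_eq_zero_iff_dvd]

variable {p} in
/-- `dUU l` is open (a preimage under the continuous level map into the discrete `Heis (ℤ/l)`).
[cite: MochizukiEtTh2009, Def 2.5 (i) p.39] -/
theorem isOpen_dUU (l : ℕ+) : IsOpen (dUU l : Set Gfp) := by
  have e : (dUU l : Set Gfp) = levelHom l ⁻¹' {h : Heis (ZMod l) | h.x = 0 ∧ h.z = 0} := rfl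
  rw [e]
  exact (isOpen_discrete _).preimage (levelHom_continuous l)

/-- **`dUU l` is stable under the Galois twist** `θ_{χ σ}` (level shadow `diagTwist (χ_l σ)`: `x` fixed,
`z ↦ χ_l σ · z`). [cite: MochizukiEtTh2009, Def 2.5 (i) p.39] -/
theorem actχ_mem_dUU (l : ℕ+) (σ : GQp p) ⦃γ : Gfp⦄ (hγ : γ ∈ dUU l) : actχ p σ γ ∈ dUU l := by
  obtain ⟨hx, hz⟩ := hγ
  have h : levelHom l (actχ p σ γ) =
      Heis.diagTwist (ZHatLevel.levelChar l (chi p σ)) (levelHom l γ) :=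
    (chiTwistData p).hlev l σ γ
  refine ⟨?_, ?_⟩
  · rw [h, Heis.diagTwist_apply]
    exact hx
  · rw [h, Heis.diagTwist_apply]
    change _ * (levelHom l γ).z = 0
    rw [hz, mul_zero]

/-! ### `Π^tp_X̲̲ := dUU l ⋊ G_{ℚ_p}` -/

/-- **`Π^tp_X̲̲` in the χ-model**: `{(γ, σ) | γ ∈ dUU l}` = `dUU l ⋊_χ G_{ℚ_p}` — the covering `X̲̲ → X` of type
`(1, (ℤ/l)^Θ)` CHOSEN explicitly. [cite: MochizukiEtTh2009, Def 2.5 (i) p.39] -/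
def Huuχ (l : ℕ+) : Subgroup (PiTpχ p) :=
  Semidirect.twistedProd (dUU l) ⊤ (Semidirect.stable_of_forall (actχ_mem_dUU p l) ⊤)

/-- Membership in `Π^tp_X̲̲`: `ĥ_l(pr₁ g.left)` has `x = 0` and `z = 0`. [cite: MochizukiEtTh2009, Def 2.5 (i) p.39] -/
theorem mem_Huuχ_iff (l : ℕ+) (g : PiTpχ p) :
    g ∈ Huuχ p l ↔ (levelHom l g.left).x = 0 ∧ (levelHom l g.left).z = 0 := by
  change g.left ∈ dUU l ∧ g.right ∈ (⊤ : Subgroup (GQp p)) ↔ _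
  rw [and_iff_left (Subgroup.mem_top _)]
  rfl

/-- `inl γ ∈ Π^tp_X̲̲ ↔ γ ∈ dUU l`. [cite: MochizukiEtTh2009, Def 2.5 (i) p.39] -/
theorem inl_mem_Huuχ_iff (l : ℕ+) (γ : Gfp) :
    (SemidirectProduct.inl γ : PiTpχ p) ∈ Huuχ p l ↔ γ ∈ dUU l := by
  rw [mem_Huuχ_iff, SemidirectProduct.left_inl]
  rfl

/-- The Galois section lies in `Π^tp_X̲̲`: `inr σ ∈ Π^tp_X̲̲`. [cite: MochizukiEtTh2009, Prop 2.2 (iii) p.37] -/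
theorem inr_mem_Huuχ (l : ℕ+) (σ : GQp p) : (SemidirectProduct.inr σ : PiTpχ p) ∈ Huuχ p l := by
  rw [mem_Huuχ_iff, SemidirectProduct.left_inr, map_one]
  exact ⟨rfl, rfl⟩

/-- **`Π^tp_X̲̲` is open** (`X̲̲ → X` finite étale). [cite: MochizukiEtTh2009, Def 2.5 (i) p.39] -/
theorem isOpen_Huuχ (l : ℕ+) : IsOpen (Huuχ p l : Set (PiTpχ p)) :=
  Semidirect.isOpen_twistedProd (continuous_leftRight p) (isOpen_dUU l)
    (by rw [Subgroup.coe_top]; exact isOpen_univ)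

/-! ### `Π^tp_Ÿ ∩ Π^tp_X̲̲ ↠ G_K` -/

/-- `inr σ ∈ Π^tp_{Y_N}` for `σ ∈ G_{K_N}`. [cite: MochizukiEtTh2009, §1 p.13] -/
theorem inr_mem_YNχ (N : ℕ+) {σ : GQp p} (hσ : σ ∈ (fieldKN ⊥ (qModel p) N).fixingSubgroup) :
    (SemidirectProduct.inr σ : PiTpχ p) ∈ YNχ p N :=
  (GfpTwistData.mem_YN _).mpr
    ⟨by rw [SemidirectProduct.left_inr]; exact Subgroup.one_mem _,
     by rw [SemidirectProduct.right_inr]; exact hσ⟩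

/-- `inr σ ∈ Π^tp_{Y₂} = Π^tp_Ÿ` for every `σ` (`K₂ = K̈ = ℚ_p`). [cite: MochizukiEtTh2009, §1 p.17] -/
theorem inr_mem_YNχ_two (σ : GQp p) : (SemidirectProduct.inr σ : PiTpχ p) ∈ YNχ p 2 :=
  inr_mem_YNχ p 2 (by
    rw [fieldKN_bot_qModel_two, IntermediateField.fixingSubgroup_bot]
    exact Subgroup.mem_top σ)

/-- **`(Π^tp_{Y₂} ∩ Π^tp_X̲̲) ↠ G_{ℚ_p} = G_K`** ("`G_K ≅ Π_X̲̲/Δ_X̲̲`", Prop. 2.2 (iii)): the clause `map_aug_Ydduu` at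
the constituents (`Π^tp_Ÿ = Π^tp_{Y₂}` under `K = K̈`). [cite: MochizukiEtTh2009, Prop 2.2 (iii) p.37] -/
theorem map_augχ_YNχ_two_inf_Huuχ (l : ℕ+) :
    (YNχ p 2 ⊓ Huuχ p l).map (augχ p).toMonoidHom = ⊤ := by
  refine eq_top_iff.mpr fun σ _ => ?_
  exact ⟨SemidirectProduct.inr σ, Subgroup.mem_inf.mpr ⟨inr_mem_YNχ_two p σ, inr_mem_Huuχ p l σ⟩, rfl⟩

/-! ### `toZ(Π^tp_X̲̲) = l·Z` -/

/-- **`toZ(Π^tp_X̲̲) = l·ℤ`** (Def. 2.5 (i): "`Π_X ↠ Q (≅ ℤ/l)` factors through `Π^tp_X ↠ Z`"; witness of degree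
exactly `l`: `(η(a^l), l)`). [cite: MochizukiEtTh2009, Def 2.5 (i) p.39] -/
theorem map_toZ_Huuχ (l : ℕ+) :
    (Huuχ p l).map (chiTwistData p).toZ = Subgroup.zpowers (Multiplicative.ofAdd ((l : ℕ) : ℤ)) := by
  apply le_antisymm
  · rintro _ ⟨g, hg, rfl⟩
    obtain ⟨⟨k, hk⟩, -⟩ := (mem_dUU_iff_dvd l g.left).mp (Semidirect.mem_twistedProd.mp hg).1
    rw [GfpTwistData.toZ_apply, Subgroup.mem_zpowers_iff]
    refine ⟨k, ?_⟩
    rw [← ofAdd_zsmul, smul_eq_mul, ← ofAdd_toAdd (gfpSnd g.left), hk, mul_comm]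
  · rw [Subgroup.zpowers_le]
    refine ⟨SemidirectProduct.inl (gfpOf (FreeGroup.of 0 ^ ((l : ℕ) : ℤ))), ?_, ?_⟩
    · rw [SetLike.mem_coe, inl_mem_Huuχ_iff, mem_dUU_iff, levelHom_gfpOf_of_zero_zpow]
      exact ⟨by simp, rfl⟩
    · rw [GfpTwistData.toZ_apply, SemidirectProduct.left_inl, gfpSnd_gfpOf, expA_of_zero_zpow]

/-! ### `[Π^tp_Y : Π^tp_Y ∩ Π^tp_X̲̲] = l` -/

/-- **`[Π^tp_Y : Π^tp_Y ∩ Π^tp_X̲̲] = l`** ("`Y̲̲ → Y` of degree `l`", p. 41) in the χ-model: `Π^tp_Y ∩ Π^tp_X̲̲` is the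
stabiliser of `0` for the transitive affine action `(γ, σ) • t := z_l(γ) + χ_l(σ)·t` of `Π^tp_Y = Ker pr₂ ⋊_χ G_{ℚ_p}`
on `ℤ/l` (on `Ker pr₂` the `z`-coordinate of `ĥ_l` is additive; the twist scales it by `χ_l`), so orbit–stabiliser
gives the index. [cite: MochizukiEtTh2009, Def 2.7 p.41] -/
theorem relIndex_Huuχ_inf_ker_toZ (l : ℕ+) :
    (Huuχ p l ⊓ (chiTwistData p).toZ.ker).relIndex (chiTwistData p).toZ.ker = l := by
  -- `x`-coordinates vanish on `Π^tp_Y`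
  have hx : ∀ g : (chiTwistData p).toZ.ker, (levelHom l (g : PiTpχ p).left).x = 0 := fun g => by
    refine levelHom_x_eq_zero ?_
    have h := g.2
    rwa [MonoidHom.mem_ker, GfpTwistData.toZ_apply] at h
  -- the affine action of `Π^tp_Y` on `ℤ/l`
  letI : SMul (chiTwistData p).toZ.ker (ZMod l) :=
    ⟨fun g t => (levelHom l (g : PiTpχ p).left).z + ZHatLevel.levelChar l (chi p (g : PiTpχ p).right) * t⟩
  have smul_def : ∀ (g : (chiTwistData p).toZ.ker) (t : ZMod l),
      g • t = (levelHom l (g : PiTpχ p).left).z + ZHatLevel.levelChar l (chi p (g : PiTpχ p).right) * t :=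
    fun _ _ => rfl
  letI : MulAction (chiTwistData p).toZ.ker (ZMod l) :=
    { one_smul := fun t => by
        simp only [smul_def, OneMemClass.coe_one, SemidirectProduct.one_left, SemidirectProduct.one_right,
          map_one, Heis.one_z, zero_add, one_mul]
      mul_smul := fun g h t => by
        have hlev : levelHom l (actχ p (g : PiTpχ p).right (h : PiTpχ p).left) =
            Heis.diagTwist (ZHatLevel.levelChar l (chi p (g : PiTpχ p).right)) (levelHom l (h : PiTpχ p).left) :=
          (chiTwistData p).hlev l _ _
        simp only [smul_def, MulMemClass.coe_mul, SemidirectProduct.mul_left, SemidirectProduct.mul_right,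
          map_mul, Heis.mul_z, hlev, Heis.diagTwist_apply, hx g, zero_mul, add_zero]
        ring }
  have hstab : (Huuχ p l ⊓ (chiTwistData p).toZ.ker).subgroupOf (chiTwistData p).toZ.ker =
      MulAction.stabilizer (chiTwistData p).toZ.ker (0 : ZMod l) := by
    ext g
    rw [Subgroup.mem_subgroupOf, MulAction.mem_stabilizer_iff, smul_def, mul_zero, add_zero, Subgroup.mem_inf,
      mem_Huuχ_iff]
    exact ⟨fun h => h.1.2, fun h => ⟨⟨hx g, h⟩, g.2⟩⟩
  have horb : MulAction.orbit (chiTwistData p).toZ.ker (0 : ZMod l) = Set.univ := by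
    refine Set.eq_univ_of_forall fun t => ?_
    obtain ⟨k, hk⟩ := ZMod.intCast_surjective t
    have hmem : (SemidirectProduct.inl (gfpOf (⁅FreeGroup.of (0 : Fin 2), FreeGroup.of 1⁆ ^ k)) : PiTpχ p) ∈
        (chiTwistData p).toZ.ker := by
      rw [MonoidHom.mem_ker, GfpTwistData.toZ_apply, SemidirectProduct.left_inl]
      exact gfpOf_commutator_zpow_mem_ker k
    rw [MulAction.mem_orbit_iff]
    refine ⟨⟨_, hmem⟩, ?_⟩
    rw [smul_def, mul_zero, add_zero, Subgroup.coe_mk, SemidirectProduct.left_inl,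
      levelHom_gfpOf_commutator_zpow]
    exact hk
  rw [Subgroup.relIndex, hstab, MulAction.index_stabilizer, horb, Set.ncard_univ, Nat.card_zmod]

/-! ### `θ(Π^tp_X̲̲) ∩ Δ_Θ = l·Δ_Θ` -/

variable {p} in
/-- An element of `Γ ⋊_χ G_{ℚ_p}` with trivial Galois component is `inl` of its `Γ`-component.
[cite: MochizukiEtTh2009, §1 p.12] -/
theorem eq_inl_of_right_eq_one {g : PiTpχ p} (hg : g.right = 1) : g = SemidirectProduct.inl g.left :=
  SemidirectProduct.ext (by simp) (by simp [hg])

/-- **`(Δ_Θ)^l ⊆ θ(Π^tp_X̲̲)`**: for `y ∈ Δ_Θ = Ker((Π^tp_X)^Θ ↠ (Π^tp_X)^ell)`, `y^l ∈ toTheta(Π^tp_X̲̲)` (a lift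
`g ∈ Ker(Π^tp_X ↠ (Π^tp_X)^ell)` of `y` has levels `(0, 0, z)`, so `g^l` has level-`l` shadow `(0, 0, l·z) = 1`).
[cite: MochizukiEtTh2009, Prop 2.12 (i) p.45] -/
theorem pow_mem_map_toTheta_Huuχ (l : ℕ+) {y : CurveTheta.GTheta (curveχ p)}
    (hy : y ∈ (CurveTheta.thetaToEll (curveχ p)).ker) :
    y ^ (l : ℕ) ∈ (Huuχ p l).map (CurveTheta.toTheta (curveχ p)) := by
  obtain ⟨g, hg, rfl⟩ := CurveTheta.exists_eq_toTheta_of_mem_ker_thetaToEll _ hy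
  obtain ⟨hxy, hright⟩ := (mem_ellKerχ_iff p g).mp hg
  refine ⟨g ^ (l : ℕ), ?_, map_pow _ _ _⟩
  rw [SetLike.mem_coe, mem_Huuχ_iff, eq_inl_of_right_eq_one hright, ← map_pow, SemidirectProduct.left_inl,
    map_pow, Heis.pow_eq_of_x_eq_zero (levelHom l g.left) (hxy l).1]
  refine ⟨rfl, ?_⟩
  change ((l : ℕ) : ZMod l) * _ = 0
  rw [ZMod.natCast_self, zero_mul]

/-- **`θ(Π^tp_X̲̲) ∩ Δ_Θ ⊆ (Δ_Θ)^l = l·Δ_Θ`** in the χ-model: an element of `toTheta(Π^tp_X̲̲) ∩ Δ_Θ` is an `l`-th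
power in `Δ_Θ`.  Via abc-iut-L6-d6's `Ẑ`-coordinate on the theta centre: a lift `g` lies in
`Ker(Π^tp_X ↠ (Π^tp_X)^ell)`, so `pr₁ g.left ≡ c^t (mod [[F̂₂,F̂₂],F̂₂]⁻)`; `z_l = 0` forces `t mod l = 0`, i.e.
`t = s^l` (`Ker(Ẑ → ℤ/l) = Ẑ^l`), and then `toTheta g = toTheta((c^s, 1))^l`. [cite: MochizukiEtTh2009, Prop 2.12 (i) p.45] -/
theorem exists_pow_eq_of_mem_map_toTheta_Huuχ (l : ℕ+) {x : CurveTheta.GTheta (curveχ p)}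
    (hx : x ∈ (Huuχ p l).map (CurveTheta.toTheta (curveχ p)))
    (hxΔ : x ∈ (CurveTheta.thetaToEll (curveχ p)).ker) :
    ∃ y ∈ (CurveTheta.thetaToEll (curveχ p)).ker, y ^ (l : ℕ) = x := by
  obtain ⟨g, hg, rfl⟩ := hx
  have hgE : g ∈ CurveTheta.ellKer (curveχ p) := (CurveTheta.mk_mem_ker_thetaToEll_iff _ g).mp hxΔ
  obtain ⟨hxy, hright⟩ := (mem_ellKerχ_iff p g).mp hgE
  obtain ⟨-, hz⟩ := (mem_Huuχ_iff p l g).mp hg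
  -- the `Ẑ`-coordinate `t` of `pr₁ g.left ∈ [F̂₂,F̂₂]⁻`
  have hxcl : gfpFst g.left ∈ (⁅(⊤ : Subgroup F₂hatT), (⊤ : Subgroup F₂hatT)⁆).topologicalClosure :=
    (mem_closure_commutator₂_iff_forall_hHat _).mpr hxy
  obtain ⟨f, hf⟩ := exists_cPow
  obtain ⟨t, -, htN⟩ := exists_mul_inv_cPow_mem_closure₃ f hf hxcl
  -- `z_l = 0` ⇒ `t mod l = 0` ⇒ `t = s^l`
  have hlev : ZHatLevel.level l t = 1 := by
    change (hHat l (gfpFst g.left)).z = 0 at hz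
    rw [htN l] at hz
    dsimp only at hz
    rw [← modN_eq_level, ← ofAdd_toAdd (modN l t), hz, ofAdd_zero]
  obtain ⟨s, hs⟩ := (ZHatLevel.level_eq_one_iff_exists_pow l t).mp hlev
  -- the element `(c^s, 1) ∈ Γ` and its image in `(Π^tp_X)^Θ`
  have hmem : ((f s, (1 : Multiplicative ℤ)) : F₂hatT × Multiplicative ℤ) ∈ Gfp := by
    rw [mem_Gfp, map_one]
    exact eHat_apply_of_cPowSpec f hf s
  have hγs : gfpFst ⟨(f s, 1), hmem⟩ = f s := rfl
  have hinl : (SemidirectProduct.inl ⟨(f s, 1), hmem⟩ : PiTpχ p) ∈ CurveTheta.ellKer (curveχ p) := by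
    rw [mem_ellKerχ_iff, SemidirectProduct.left_inl, SemidirectProduct.right_inl, hγs]
    exact ⟨fun N => by rw [hHat_apply_of_cPowSpec f hf]; exact ⟨rfl, rfl⟩, rfl⟩
  refine ⟨CurveTheta.toTheta (curveχ p) (SemidirectProduct.inl ⟨(f s, 1), hmem⟩),
    (CurveTheta.mk_mem_ker_thetaToEll_iff _ _).mpr hinl, ?_⟩
  -- `toTheta((c^s,1))^l = toTheta g` ⟸ `((c^s,1)^l)⁻¹ · g ∈ Ker(Π^tp_X ↠ (Π^tp_X)^Θ)`, read on the levels
  rw [← map_pow, CurveTheta.toTheta, QuotientGroup.mk'_apply, QuotientGroup.mk'_apply, QuotientGroup.eq,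
    mem_thetaKerχ_iff, eq_inl_of_right_eq_one hright, ← map_pow, ← map_inv, ← map_mul,
    SemidirectProduct.left_inl, SemidirectProduct.right_inl]
  refine ⟨fun N => ?_, rfl⟩
  rw [map_mul, map_inv, map_pow, hγs, ← map_pow, hs, map_mul, map_inv, htN N, hHat_apply_of_cPowSpec f hf,
    inv_mul_cancel]

end Literature.AnabelianGeometry.EtaleTheta.SettingModel

end
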